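import Mathlib
import Literature.Analysis.PDE.Wave1DNullMultiplier
import Literature.Analysis.PDE.Wave1DFluxBookkeeping
import Literature.Analysis.PDE.Wave1DExteriorEnergy
import HarnessLib

/-!
# A windowed channel-of-energy inequality on the growing side of a monotone potential

Analysis/PDE support file (everything proved, no definitions). Consider `C²` solutions of
`ψ_tt − ψ_xx + V(x)ψ = 0` on the line with `V ∈ C¹`, `V ≥ 0`, and suppose that on a half-line
`(−∞, x_w]` the potential grows at least exponentially in the precise sense

  `V′(x) ≥ 2κ V(x)`   for `x ≤ x_w`   (`κ > 0`).

(The horizon side of every Regge–Wheeler potential is of this kind: there `V ≍ e^{x/2M}`.) For Cauchy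
data supported in `(−∞, x_w − h]` — a LAG `h ≥ 0` below the "window top" `x_w` — we prove the
two-ended WINDOWED CHANNEL INEQUALITY

  `(1 − 2e^{−κh/2}) · E ≤ liminf_{t→+∞} ∫_{x < x_w − t} e(t,·) + liminf_{t→−∞} ∫_{x < x_w + t} e(t,·)`

(`e = ψ_t² + ψ_x² + Vψ²`, `E = ∫ e(0,·)`; `wave1D_nearWindowedChannel`): a datum supported at
distance `≥ h` below the window top cannot lose more than the fraction `2e^{−κh/2}` of its energy
behind BOTH lagged null lines `x = x_w ∓ t`. Nothing is assumed about `V` above `x_w`, no decay or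
spectral information is used, and the constant does not see the size of `V` (only `κ` and `h`).

Method (null-separated multipliers, `Wave1DNullMultiplier.lean`): with `α ≡ α₀ = 1 + q`,
`q = e^{−κh/2}`, and the logistic profile `β(v) = α₀ / (1 + e^{−κ(v − x_m)})`, `x_m = x_w − h/2`
(so `β′ = κβ(1 − β/α₀) ≤ κ(α₀ − β)`, `β(x_w) = 1`, `β ≤ q` on the data), the bulk of the
`Z = α∂_u + β∂_v` identity is `(2β′V − (α₀ − β)V′)ψ² ≤ 0` on `{x ≤ x_w}`, the `Z`-flux through the
roof `x = x_w − τ` dominates the energy flux, and the `Z`-energy of the data is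
`∫ [β(p+q)² + α₀(p−q)² + (α₀+β)Vψ²]` (`p = ψ_t`, `q = ψ_x`); adding the time-reversed estimate,
`(p+q)² ↔ (p−q)²`, gives `lost⁺ + lost⁻ ≤ (α₀ + q)E = (1 + 2q)E`.

Role: the abstract form of the near (horizon-side) half of the windowed photon-shell channel
inequality `WindowedShellChannels` of route PhotonSphereChannels (stmt-FinalStateConjecture-14085)
for thick shells; the lag is load-bearing (`h = 0` gives the constant `−1`), in accordance with
`Theorems/WindowedShellChannels/Negative/FalseWithoutLag.lean`.

References: the multiplier method is folklore (S. Alinhac, *Hyperbolic Partial Differential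
Equations*, 2009, Ch. 6); the statement is recorded here with its proof.
-/

noncomputable section

namespace Literature.Analysis.PDE

open MeasureTheory Set Filter Topology intervalIntegral Literature.Analysis.Calculus

/-! ### The logistic weight -/

section Logistic

variable {κ xm a₀ : ℝ}

/-- The logistic profile `v ↦ a₀ / (1 + e^{−κ(v − x_m)})` is `C¹` (indeed smooth). [folklore] -/
theorem contDiff_logisticWeight (κ xm a₀ : ℝ) :
    ContDiff ℝ 1 (fun v => a₀ / (1 + Real.exp (-(κ * (v - xm))))) := by
  refine ContDiff.div contDiff_const ?_ fun v => ?_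
  · fun_prop
  · positivity

/-- Derivative of the logistic profile: `β′ = κ β · E/(1+E)`, `E = e^{−κ(v − x_m)}`. [folklore] -/
theorem hasDerivAt_logisticWeight (κ xm a₀ v : ℝ) :
    HasDerivAt (fun v => a₀ / (1 + Real.exp (-(κ * (v - xm)))))
      (κ * (a₀ / (1 + Real.exp (-(κ * (v - xm)))))
        * (Real.exp (-(κ * (v - xm))) / (1 + Real.exp (-(κ * (v - xm)))))) v := by
  have hE : HasDerivAt (fun v => Real.exp (-(κ * (v - xm))))
      (Real.exp (-(κ * (v - xm))) * (-(κ * 1))) v := by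
    have hin : HasDerivAt (fun v => -(κ * (v - xm))) (-(κ * 1)) v :=
      (((hasDerivAt_id v).sub_const xm).const_mul κ).neg
    exact (Real.hasDerivAt_exp _).comp v hin
  have hden : HasDerivAt (fun v => 1 + Real.exp (-(κ * (v - xm))))
      (0 + Real.exp (-(κ * (v - xm))) * (-(κ * 1))) v := (hasDerivAt_const v 1).add hE
  have hpos : (1 + Real.exp (-(κ * (v - xm)))) ≠ 0 := by positivity
  have h := (hasDerivAt_const v a₀).div hden hpos
  refine h.congr_deriv ?_
  field_simp
  ring

/-- The logistic profile takes values in `[0, a₀]` (`a₀ ≥ 0`). [folklore] -/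
theorem logisticWeight_mem (ha₀ : 0 ≤ a₀) (κ xm v : ℝ) :
    0 ≤ a₀ / (1 + Real.exp (-(κ * (v - xm)))) ∧ a₀ / (1 + Real.exp (-(κ * (v - xm)))) ≤ a₀ := by
  have hpos : 0 < 1 + Real.exp (-(κ * (v - xm))) := by positivity
  refine ⟨div_nonneg ha₀ hpos.le, ?_⟩
  rw [div_le_iff₀ hpos]
  nlinarith [Real.exp_pos (-(κ * (v - xm)))]

/-- The logistic differential inequality `β′ ≤ κ (a₀ − β)` (`κ, a₀ ≥ 0`). [folklore] -/
theorem deriv_logisticWeight_le (hκ : 0 ≤ κ) (ha₀ : 0 ≤ a₀) (xm v : ℝ) :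
    deriv (fun v => a₀ / (1 + Real.exp (-(κ * (v - xm))))) v
      ≤ κ * (a₀ - a₀ / (1 + Real.exp (-(κ * (v - xm))))) := by
  rw [(hasDerivAt_logisticWeight κ xm a₀ v).deriv]
  set E : ℝ := Real.exp (-(κ * (v - xm))) with hE
  have hEpos : 0 < E := Real.exp_pos _
  have hpos : 0 < 1 + E := by positivity
  have hsub : a₀ - a₀ / (1 + E) = a₀ * (E / (1 + E)) := by
    field_simp
    ring
  rw [hsub]
  have hfrac : E / (1 + E) ≤ 1 := by
    rw [div_le_one hpos]; linarith
  have hfrac0 : 0 ≤ E / (1 + E) := div_nonneg hEpos.le hpos.le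
  have hβle : a₀ / (1 + E) ≤ a₀ := (logisticWeight_mem ha₀ κ xm v).2
  calc κ * (a₀ / (1 + E)) * (E / (1 + E))
      ≤ κ * a₀ * (E / (1 + E)) := by
        have : κ * (a₀ / (1 + E)) ≤ κ * a₀ := mul_le_mul_of_nonneg_left hβle hκ
        exact mul_le_mul_of_nonneg_right this hfrac0
    _ = κ * (a₀ * (E / (1 + E))) := by ring

/-- Value at the window top: with `a₀ = 1 + e^{−κh/2}` and `x_m = x_w − h/2`, `β(x_w) = 1`.
[folklore] -/
theorem logisticWeight_top (κ xw h : ℝ) :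
    (1 + Real.exp (-(κ * h / 2))) / (1 + Real.exp (-(κ * (xw - (xw - h / 2))))) = 1 := by
  have : κ * (xw - (xw - h / 2)) = κ * h / 2 := by ring
  rw [this, div_self]
  positivity

/-- Value on the data: with `a₀ = 1 + q`, `q = e^{−κh/2}`, `x_m = x_w − h/2` and `κ ≥ 0`, for
`v ≤ x_w − h` one has `β(v) ≤ q`. [folklore] -/
theorem logisticWeight_le_of_le (hκ : 0 ≤ κ) {xw h v : ℝ} (hv : v ≤ xw - h) :
    (1 + Real.exp (-(κ * h / 2))) / (1 + Real.exp (-(κ * (v - (xw - h / 2)))))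
      ≤ Real.exp (-(κ * h / 2)) := by
  set q : ℝ := Real.exp (-(κ * h / 2)) with hq
  have hqpos : 0 < q := Real.exp_pos _
  -- `e^{−κ(v − x_m)} ≥ e^{κh/2} = 1/q`
  have harg : κ * h / 2 ≤ -(κ * (v - (xw - h / 2))) := by
    have : v - (xw - h / 2) ≤ -(h / 2) := by linarith
    nlinarith
  have hexp : Real.exp (κ * h / 2) ≤ Real.exp (-(κ * (v - (xw - h / 2)))) :=
    Real.exp_le_exp.2 harg
  have hinv : Real.exp (κ * h / 2) = q⁻¹ := by
    rw [hq, ← Real.exp_neg]; ring_nf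
  have hden : 1 + q⁻¹ ≤ 1 + Real.exp (-(κ * (v - (xw - h / 2)))) := by linarith [hinv ▸ hexp]
  have hdenpos : 0 < 1 + q⁻¹ := by positivity
  calc (1 + q) / (1 + Real.exp (-(κ * (v - (xw - h / 2)))))
      ≤ (1 + q) / (1 + q⁻¹) := by
        apply div_le_div_of_nonneg_left (by positivity) hdenpos hden
    _ = q := by
        field_simp
        ring

end Logistic

/-! ### The roof-flux bound from the null-multiplier identity -/

section Roof

variable {V : ℝ → ℝ} {ψ : ℝ → ℝ → ℝ}

/-- **Roof-flux bound.** Let `V ∈ C¹`, `V ≥ 0` and `V′ ≥ 2κV` on `(−∞, x_w]` (`κ ∈ ℝ`); let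
`α₀ ≥ 1` and `β ∈ C¹` with `0 ≤ β ≤ α₀`, `β′ ≤ κ(α₀ − β)` and `β(x_w) ≥ 1`. Then for every `C²`
solution of `ψ_tt − ψ_xx + Vψ = 0`, every `t ≥ 0` and every base point `b` with `b + t ≤ x_w − t`,
the energy flux through the roof `x = x_w − τ`, `0 ≤ τ ≤ t`, is at most half the `Z`-energy of the
time-`0` data on `[b, x_w]`:
`∫_{x_w−t}^{x_w} [(ψ_t − ψ_x)² + Vψ²](x_w − x, x) dx ≤ ½ ∫_b^{x_w} [β(p+q)² + α₀(p−q)² + (α₀+β)Vψ²](0,x) dx`.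
(Null-multiplier identity on the trapezoid `{b + τ ≤ x ≤ x_w − τ}`: the top `Z`-energy and the left
flux are non-negative, the bulk `(2β′V − (α₀−β)V′)ψ²` is non-positive, and the roof `Z`-flux
`2α₀(p−q)² + 2β(x_w)Vψ²` dominates twice the energy flux.) [folklore] -/
theorem wave1D_roofFlux_le_nullEnergy (hV : ContDiff ℝ 1 V) (hV0 : ∀ x, 0 ≤ V x) {κ xw : ℝ}
    (hmono : ∀ x, x ≤ xw → 2 * κ * V x ≤ deriv V x)
    {α₀ : ℝ} (hα₀ : 1 ≤ α₀) {β : ℝ → ℝ} (hβ : ContDiff ℝ 1 β) (hβ0 : ∀ v, 0 ≤ β v)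
    (hβ1 : ∀ v, β v ≤ α₀) (hβ' : ∀ v, deriv β v ≤ κ * (α₀ - β v)) (hβw : 1 ≤ β xw)
    (hψ : ContDiff ℝ 2 (Function.uncurry ψ))
    (hsol : ∀ t x, iteratedDeriv 2 (fun τ => ψ τ x) t - iteratedDeriv 2 (ψ t) x + V x * ψ t x = 0)
    {b t : ℝ} (ht : 0 ≤ t) (hb : b + t ≤ xw - t) :
    ∫ x in (xw - t)..xw, ((deriv (fun τ => ψ τ x) (xw - x) - deriv (ψ (xw - x)) x) ^ 2
        + V x * ψ (xw - x) x ^ 2)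
      ≤ (1 / 2) * ∫ x in b..xw,
        (β x * (deriv (fun τ => ψ τ x) 0 + deriv (ψ 0) x) ^ 2
          + α₀ * (deriv (fun τ => ψ τ x) 0 - deriv (ψ 0) x) ^ 2
          + (α₀ + β x) * V x * ψ 0 x ^ 2) := by
  have key := wave1D_nullMultiplier_trapezoid_identity (α := fun _ => α₀) hV contDiff_const hβ hψ
    hsol (a := b) (b := xw) (s := 0) ht hb
  simp only [zero_add, add_zero, sub_zero, deriv_const'] at key
  -- signs of the four terms
  have htop : 0 ≤ ∫ x in (b + t)..(xw - t),
      (β (t + x) * (deriv (fun τ => ψ τ x) t + deriv (ψ t) x) ^ 2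
        + α₀ * (deriv (fun τ => ψ τ x) t - deriv (ψ t) x) ^ 2
        + (α₀ + β (t + x)) * V x * ψ t x ^ 2) :=
    intervalIntegral.integral_nonneg hb fun x _ => by
      have h1 := hβ0 (t + x); have h2 := hV0 x
      have h3 : 0 ≤ α₀ := by linarith
      positivity
  have hleft : 0 ≤ ∫ x in b..(b + t),
      (2 * β (2 * x - b) * (deriv (fun τ => ψ τ x) (x - b) + deriv (ψ (x - b)) x) ^ 2
        + 2 * α₀ * V x * ψ (x - b) x ^ 2) :=
    intervalIntegral.integral_nonneg (by linarith) fun x _ => by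
      have h1 := hβ0 (2 * x - b); have h2 := hV0 x
      have h3 : 0 ≤ α₀ := by linarith
      positivity
  have hbulk : (∫ τ in (0 : ℝ)..t, ∫ x in (b + τ)..(xw - τ),
      ((2 * deriv β (τ + x) * V x + (β (τ + x) - α₀) * deriv V x) * ψ τ x ^ 2)) ≤ 0 := by
    rw [integral_of_le ht]
    refine setIntegral_nonpos measurableSet_Ioc fun τ hτ => ?_
    have hτ0 : 0 ≤ τ := hτ.1.le
    have hτt : τ ≤ t := hτ.2
    rw [integral_of_le (by linarith)]
    refine setIntegral_nonpos measurableSet_Ioc fun x hx => ?_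
    have hxw : x ≤ xw := by linarith [hx.2]
    have hVm := hmono x hxw
    have hβd := hβ' (τ + x)
    have hco : (2 * deriv β (τ + x) * V x + (β (τ + x) - α₀) * deriv V x) ≤ 0 := by
      have hαβ : 0 ≤ α₀ - β (τ + x) := by linarith [hβ1 (τ + x)]
      have hV0x := hV0 x
      nlinarith [mul_le_mul_of_nonneg_left hVm hαβ, mul_le_mul_of_nonneg_right hβd hV0x]
    exact mul_nonpos_of_nonpos_of_nonneg hco (sq_nonneg _)
  -- the roof `Z`-flux dominates twice the energy flux
  have hroof : 2 * ∫ x in (xw - t)..xw, ((deriv (fun τ => ψ τ x) (xw - x) - deriv (ψ (xw - x)) x) ^ 2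
        + V x * ψ (xw - x) x ^ 2)
      ≤ ∫ x in (xw - t)..xw,
        (2 * α₀ * (deriv (fun τ => ψ τ x) (xw - x) - deriv (ψ (xw - x)) x) ^ 2
          + 2 * β xw * V x * ψ (xw - x) x ^ 2) := by
    rw [← intervalIntegral.integral_const_mul]
    refine intervalIntegral.integral_mono_on (by linarith) ?_ ?_ fun x _ => ?_
    · refine Continuous.intervalIntegrable ?_ _ _
      obtain ⟨ψt, ψx, -, -, -, hct, hcx, -, -, -, h1, h2, -⟩ := exists_partials_of_contDiff_two hψ
      have hd1 : ∀ t x, deriv (fun τ => ψ τ x) t = ψt t x := fun t x => (h1 t x).deriv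
      have hd2 : ∀ t x, deriv (ψ t) x = ψx t x := fun t x => (h2 t x).deriv
      simp only [hd1, hd2]
      have ha : Continuous fun p : ℝ × ℝ => ψt p.1 p.2 := hct
      have hb' : Continuous fun p : ℝ × ℝ => ψx p.1 p.2 := hcx
      have hc : Continuous fun p : ℝ × ℝ => ψ p.1 p.2 := hψ.continuous
      have hVc : Continuous V := hV.continuous
      fun_prop
    · refine Continuous.intervalIntegrable ?_ _ _
      obtain ⟨ψt, ψx, -, -, -, hct, hcx, -, -, -, h1, h2, -⟩ := exists_partials_of_contDiff_two hψ
      have hd1 : ∀ t x, deriv (fun τ => ψ τ x) t = ψt t x := fun t x => (h1 t x).deriv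
      have hd2 : ∀ t x, deriv (ψ t) x = ψx t x := fun t x => (h2 t x).deriv
      simp only [hd1, hd2]
      have ha : Continuous fun p : ℝ × ℝ => ψt p.1 p.2 := hct
      have hb' : Continuous fun p : ℝ × ℝ => ψx p.1 p.2 := hcx
      have hc : Continuous fun p : ℝ × ℝ => ψ p.1 p.2 := hψ.continuous
      have hVc : Continuous V := hV.continuous
      fun_prop
    · have h2 := hV0 x
      have hsq := sq_nonneg (deriv (fun τ => ψ τ x) (xw - x) - deriv (ψ (xw - x)) x)
      have hψ2 := sq_nonneg (ψ (xw - x) x)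
      nlinarith [mul_nonneg h2 hψ2, mul_le_mul_of_nonneg_right hα₀ hsq,
        mul_le_mul_of_nonneg_right hβw (mul_nonneg h2 hψ2)]
  linarith

end Roof

/-! ### The forward windowed estimate -/

section Forward

variable {V : ℝ → ℝ} {ψ : ℝ → ℝ → ℝ}

/-- **Forward windowed estimate.** Under the hypotheses of `wave1D_roofFlux_le_nullEnergy`, if the
time-`0` energy below the window top is finite, then for every `t ≥ 0` the energy to the left of the
lagged null line `x = x_w − t` at time `t` is at least
`∫_{x ≤ x_w} (e − ½[β(p+q)² + α₀(p−q)² + (α₀+β)Vψ²])(0,x) dx`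
(`e = p² + q² + Vψ²`, `p = ψ_t`, `q = ψ_x`): truncated energy bookkeeping
(`wave1D_truncated_energy_ge`) plus the roof-flux bound, then the truncation is removed. [folklore] -/
theorem wave1D_nearWindow_forward_ge (hV : ContDiff ℝ 1 V) (hV0 : ∀ x, 0 ≤ V x) {κ xw : ℝ}
    (hmono : ∀ x, x ≤ xw → 2 * κ * V x ≤ deriv V x)
    {α₀ : ℝ} (hα₀ : 1 ≤ α₀) {β : ℝ → ℝ} (hβ : ContDiff ℝ 1 β) (hβ0 : ∀ v, 0 ≤ β v)
    (hβ1 : ∀ v, β v ≤ α₀) (hβ' : ∀ v, deriv β v ≤ κ * (α₀ - β v)) (hβw : 1 ≤ β xw)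
    (hψ : ContDiff ℝ 2 (Function.uncurry ψ))
    (hsol : ∀ t x, iteratedDeriv 2 (fun τ => ψ τ x) t - iteratedDeriv 2 (ψ t) x + V x * ψ t x = 0)
    (hfin : ∫⁻ x in Iic xw, ENNReal.ofReal
        (deriv (fun τ => ψ τ x) 0 ^ 2 + deriv (ψ 0) x ^ 2 + V x * ψ 0 x ^ 2) ≠ ⊤)
    {t : ℝ} (ht : 0 ≤ t) :
    ENNReal.ofReal (∫ x in Iic xw,
        ((deriv (fun τ => ψ τ x) 0 ^ 2 + deriv (ψ 0) x ^ 2 + V x * ψ 0 x ^ 2)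
          - (1 / 2) * (β x * (deriv (fun τ => ψ τ x) 0 + deriv (ψ 0) x) ^ 2
            + α₀ * (deriv (fun τ => ψ τ x) 0 - deriv (ψ 0) x) ^ 2
            + (α₀ + β x) * V x * ψ 0 x ^ 2)))
      ≤ ∫⁻ x in Iio (xw - t), ENNReal.ofReal
        (deriv (fun τ => ψ τ x) t ^ 2 + deriv (ψ t) x ^ 2 + V x * ψ t x ^ 2) := by
  have hVc : Continuous V := hV.continuous
  obtain ⟨ψt, ψx, -, -, -, hct, hcx, -, -, -, h1, h2, -⟩ := exists_partials_of_contDiff_two hψ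
  have hd1 : ∀ t x, deriv (fun τ => ψ τ x) t = ψt t x := fun t x => (h1 t x).deriv
  have hd2 : ∀ t x, deriv (ψ t) x = ψx t x := fun t x => (h2 t x).deriv
  -- densities at time `0`
  set e0 : ℝ → ℝ := fun x => deriv (fun τ => ψ τ x) 0 ^ 2 + deriv (ψ 0) x ^ 2 + V x * ψ 0 x ^ 2
    with he0
  set Z0 : ℝ → ℝ := fun x => β x * (deriv (fun τ => ψ τ x) 0 + deriv (ψ 0) x) ^ 2
    + α₀ * (deriv (fun τ => ψ τ x) 0 - deriv (ψ 0) x) ^ 2 + (α₀ + β x) * V x * ψ 0 x ^ 2 with hZ0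
  have he0_nn : ∀ x, 0 ≤ e0 x := fun x => wave1D_energyDensity_nonneg hV0 0 x
  have hα0' : 0 ≤ α₀ := by linarith
  have hZ0_nn : ∀ x, 0 ≤ Z0 x := fun x => by
    simp only [hZ0]
    have := hβ0 x; have := hV0 x
    positivity
  have hZ0_le : ∀ x, Z0 x ≤ 2 * α₀ * e0 x := fun x => by
    simp only [hZ0, he0]
    have hb0 := hβ0 x; have hb1 := hβ1 x; have hv := hV0 x
    set p := deriv (fun τ => ψ τ x) 0
    set q := deriv (ψ 0) x
    have hψ2 := sq_nonneg (ψ 0 x)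
    nlinarith [mul_le_mul_of_nonneg_right hb1 (sq_nonneg (p + q)),
      mul_le_mul_of_nonneg_right hb1 (mul_nonneg hv hψ2), sq_nonneg (p - q), sq_nonneg (p + q),
      mul_nonneg hα0' (sq_nonneg (p + q)), mul_nonneg hα0' (sq_nonneg (p - q))]
  have he0_cont : Continuous e0 := by
    simp only [he0, hd1, hd2]
    have ha : Continuous fun p : ℝ × ℝ => ψt p.1 p.2 := hct
    have hb' : Continuous fun p : ℝ × ℝ => ψx p.1 p.2 := hcx
    have hc : Continuous fun p : ℝ × ℝ => ψ p.1 p.2 := hψ.continuous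
    fun_prop
  have hβc : Continuous β := hβ.continuous
  have hZ0_cont : Continuous Z0 := by
    simp only [hZ0, hd1, hd2]
    have ha : Continuous fun p : ℝ × ℝ => ψt p.1 p.2 := hct
    have hb' : Continuous fun p : ℝ × ℝ => ψx p.1 p.2 := hcx
    have hc : Continuous fun p : ℝ × ℝ => ψ p.1 p.2 := hψ.continuous
    fun_prop
  -- integrability on `Iic xw`
  have he0_int : IntegrableOn e0 (Iic xw) := by
    refine ⟨he0_cont.aestronglyMeasurable, ?_⟩
    rw [hasFiniteIntegral_iff_ofReal (ae_of_all _ fun x => he0_nn x)]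
    exact lt_top_iff_ne_top.2 hfin
  have hZ0_int : IntegrableOn Z0 (Iic xw) := by
    refine Integrable.mono' (he0_int.const_mul (2 * α₀)) hZ0_cont.aestronglyMeasurable
      (ae_of_all _ fun x => ?_)
    rw [Real.norm_eq_abs, abs_of_nonneg (hZ0_nn x)]
    exact hZ0_le x
  set R : ℝ := (1 / 2) * ∫ x in Iic xw, Z0 x with hR
  -- the truncated estimate: for `y ≤ xw`, with base point `b = y - 2t`
  have htrunc : ∀ y, y ≤ xw →
      ENNReal.ofReal ((∫ x in y..xw, e0 x) - R)
        ≤ ∫⁻ x in Iio (xw - t), ENNReal.ofReal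
          (deriv (fun τ => ψ τ x) t ^ 2 + deriv (ψ t) x ^ 2 + V x * ψ t x ^ 2) := by
    intro y hy
    have hb : (y - 2 * t) + 2 * t ≤ xw := by linarith
    have hge := wave1D_truncated_energy_ge hVc hV0 hψ hsol (a := xw) (b := y - 2 * t) ht hb
    have hroof := wave1D_roofFlux_le_nullEnergy hV hV0 hmono hα₀ hβ hβ0 hβ1 hβ' hβw hψ hsol
      (b := y - 2 * t) ht (by linarith)
    -- `∫_{y-2t}^{xw} Z0 ≤ ∫_{Iic xw} Z0`
    have hZmono : (∫ x in (y - 2 * t)..xw, Z0 x) ≤ ∫ x in Iic xw, Z0 x := by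
      rw [integral_of_le (by linarith)]
      exact setIntegral_mono_set hZ0_int (ae_of_all _ fun x => hZ0_nn x)
        (ae_of_all _ Ioc_subset_Iic_self)
    have hy2 : y - 2 * t + 2 * t = y := by ring
    rw [hy2] at hge
    have hstep : (∫ x in y..xw, e0 x) - R
        ≤ ∫ x in (y - 2 * t + t)..(xw - t),
          (deriv (fun τ => ψ τ x) t ^ 2 + deriv (ψ t) x ^ 2 + V x * ψ t x ^ 2) := by
      simp only [hR, he0]
      have hZ : (∫ x in (y - 2 * t)..xw, Z0 x) = ∫ x in (y - 2 * t)..xw,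
          (β x * (deriv (fun τ => ψ τ x) 0 + deriv (ψ 0) x) ^ 2
            + α₀ * (deriv (fun τ => ψ τ x) 0 - deriv (ψ 0) x) ^ 2
            + (α₀ + β x) * V x * ψ 0 x ^ 2) := by simp only [hZ0]
      rw [← hZ] at hroof
      linarith
    calc ENNReal.ofReal ((∫ x in y..xw, e0 x) - R)
        ≤ ENNReal.ofReal (∫ x in (y - 2 * t + t)..(xw - t),
            (deriv (fun τ => ψ τ x) t ^ 2 + deriv (ψ t) x ^ 2 + V x * ψ t x ^ 2)) :=
          ENNReal.ofReal_le_ofReal hstep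
      _ = ∫⁻ x in Ioc (y - 2 * t + t) (xw - t), ENNReal.ofReal
            (deriv (fun τ => ψ τ x) t ^ 2 + deriv (ψ t) x ^ 2 + V x * ψ t x ^ 2) :=
          (lintegral_Ioc_wave1D_energy_eq hVc hV0 hψ t (by linarith)).symm
      _ ≤ ∫⁻ x in Iic (xw - t), ENNReal.ofReal
            (deriv (fun τ => ψ τ x) t ^ 2 + deriv (ψ t) x ^ 2 + V x * ψ t x ^ 2) :=
          lintegral_mono_set Ioc_subset_Iic_self
      _ = ∫⁻ x in Iio (xw - t), ENNReal.ofReal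
            (deriv (fun τ => ψ τ x) t ^ 2 + deriv (ψ t) x ^ 2 + V x * ψ t x ^ 2) :=
          (setLIntegral_congr (Iio_ae_eq_Iic (μ := volume) (a := xw - t))).symm
  -- remove the truncation: `∫_y^{xw} e0 → ∫_{Iic xw} e0` as `y → -∞`
  have hlim : Tendsto (fun y => ENNReal.ofReal ((∫ x in y..xw, e0 x) - R)) atBot
      (𝓝 (ENNReal.ofReal ((∫ x in Iic xw, e0 x) - R))) := by
    have h1 : Tendsto (fun y => ∫ x in y..xw, e0 x) atBot (𝓝 (∫ x in Iic xw, e0 x)) :=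
      intervalIntegral_tendsto_integral_Iic xw he0_int tendsto_id
    exact ENNReal.continuous_ofReal.continuousAt.tendsto.comp (h1.sub_const R)
  have hmain := le_of_tendsto hlim (Filter.Eventually.mono (eventually_le_atBot xw) htrunc)
  -- identify the left-hand side
  have hsub : (∫ x in Iic xw,
        ((deriv (fun τ => ψ τ x) 0 ^ 2 + deriv (ψ 0) x ^ 2 + V x * ψ 0 x ^ 2)
          - (1 / 2) * (β x * (deriv (fun τ => ψ τ x) 0 + deriv (ψ 0) x) ^ 2
            + α₀ * (deriv (fun τ => ψ τ x) 0 - deriv (ψ 0) x) ^ 2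
            + (α₀ + β x) * V x * ψ 0 x ^ 2))) = (∫ x in Iic xw, e0 x) - R := by
    rw [hR, ← MeasureTheory.integral_const_mul, ← integral_sub he0_int (hZ0_int.const_mul (1 / 2))]
  rw [hsub]
  exact hmain

end Forward

/-! ### The two-ended windowed channel inequality -/

section TwoSided

variable {V : ℝ → ℝ} {ψ : ℝ → ℝ → ℝ}

/-- **Windowed channel inequality on the growing side of the potential.** Let `V ∈ C¹`, `V ≥ 0`,
`κ ≥ 0`, and `V′ ≥ 2κV` on `(−∞, x_w]`. Let `ψ` be a global `C²` solution of
`ψ_tt − ψ_xx + V(x)ψ = 0` whose Cauchy data vanish on `[x_w − h, ∞)` (`h ≥ 0`). Then, with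
`e = ψ_t² + ψ_x² + Vψ²`,
`(1 − 2e^{−κh/2}) ∫ e(0,·) ≤ liminf_{t→+∞} ∫_{x < x_w − t} e(t,·) + liminf_{t→−∞} ∫_{x < x_w + t} e(t,·)`
(lower Lebesgue integrals; for infinite energy both sides are `∞`). The lag `h` is load-bearing:
the constant is positive iff `κh > 2 log 2`. [folklore] -/
theorem wave1D_nearWindowedChannel (hV : ContDiff ℝ 1 V) (hV0 : ∀ x, 0 ≤ V x) {κ xw h : ℝ}
    (hκ : 0 ≤ κ) (hh : 0 ≤ h) (hmono : ∀ x, x ≤ xw → 2 * κ * V x ≤ deriv V x)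
    (hψ : ContDiff ℝ 2 (Function.uncurry ψ))
    (hsol : ∀ t x, iteratedDeriv 2 (fun τ => ψ τ x) t - iteratedDeriv 2 (ψ t) x + V x * ψ t x = 0)
    (hsupp : ∀ x, xw - h ≤ x → ψ 0 x = 0 ∧ deriv (fun τ => ψ τ x) 0 = 0) :
    ENNReal.ofReal (1 - 2 * Real.exp (-(κ * h / 2)))
        * ∫⁻ x, ENNReal.ofReal (deriv (fun τ => ψ τ x) 0 ^ 2 + deriv (ψ 0) x ^ 2 + V x * ψ 0 x ^ 2)
      ≤ liminf (fun t => ∫⁻ x in Iio (xw - t), ENNReal.ofReal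
            (deriv (fun τ => ψ τ x) t ^ 2 + deriv (ψ t) x ^ 2 + V x * ψ t x ^ 2)) atTop
        + liminf (fun t => ∫⁻ x in Iio (xw + t), ENNReal.ofReal
            (deriv (fun τ => ψ τ x) t ^ 2 + deriv (ψ t) x ^ 2 + V x * ψ t x ^ 2)) atBot := by
  have hVc : Continuous V := hV.continuous
  obtain ⟨ψt, ψx, -, -, -, hct, hcx, -, -, -, h1, h2, -⟩ := exists_partials_of_contDiff_two hψ
  have hd1 : ∀ t x, deriv (fun τ => ψ τ x) t = ψt t x := fun t x => (h1 t x).deriv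
  have hd2 : ∀ t x, deriv (ψ t) x = ψx t x := fun t x => (h2 t x).deriv
  set e0 : ℝ → ℝ := fun x => deriv (fun τ => ψ τ x) 0 ^ 2 + deriv (ψ 0) x ^ 2 + V x * ψ 0 x ^ 2
    with he0
  have he0_nn : ∀ x, 0 ≤ e0 x := fun x => wave1D_energyDensity_nonneg hV0 0 x
  have he0_cont : Continuous e0 := by
    simp only [he0, hd1, hd2]
    have ha : Continuous fun p : ℝ × ℝ => ψt p.1 p.2 := hct
    have hb' : Continuous fun p : ℝ × ℝ => ψx p.1 p.2 := hcx
    have hc : Continuous fun p : ℝ × ℝ => ψ p.1 p.2 := hψ.continuous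
    fun_prop
  -- the data vanish above `xw - h`, hence so does the time-`0` energy density
  have he0_zero : ∀ x, xw - h < x → e0 x = 0 := by
    intro x hx
    have hψ0 : ψ 0 x = 0 := (hsupp x hx.le).1
    have hψt0 : deriv (fun τ => ψ τ x) 0 = 0 := (hsupp x hx.le).2
    have hψx0 : deriv (ψ 0) x = 0 := by
      have hev : (ψ 0) =ᶠ[𝓝 x] fun _ => (0 : ℝ) := by
        filter_upwards [Ioi_mem_nhds hx] with y hy using (hsupp y (le_of_lt hy)).1
      rw [hev.deriv_eq, deriv_const]
    simp only [he0, hψ0, hψt0, hψx0]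
    ring
  -- infinite energy: both sides are `∞`
  by_cases htop : ∫⁻ x in Iio xw, ENNReal.ofReal (e0 x) = ⊤
  · have hfw : ∀ t, 0 ≤ t → (∫⁻ x in Iio (xw - t), ENNReal.ofReal
        (deriv (fun τ => ψ τ x) t ^ 2 + deriv (ψ t) x ^ 2 + V x * ψ t x ^ 2)) = ⊤ := fun t ht =>
      wave1D_lintegral_Iio_energy_eq_top_of_nonneg hVc hV0 hψ hsol htop ht
    have hlim : liminf (fun t => ∫⁻ x in Iio (xw - t), ENNReal.ofReal
        (deriv (fun τ => ψ τ x) t ^ 2 + deriv (ψ t) x ^ 2 + V x * ψ t x ^ 2)) atTop = ⊤ := by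
      refine top_unique (le_liminf_of_le (h := ?_))
      filter_upwards [eventually_ge_atTop 0] with t ht
      exact (hfw t ht).ge
    rw [hlim, top_add]
    exact le_top
  -- finite energy
  have hfinIic : ∫⁻ x in Iic xw, ENNReal.ofReal (e0 x) ≠ ⊤ := by
    rwa [← setLIntegral_congr (Iio_ae_eq_Iic (μ := volume) (a := xw))]
  -- the weights
  set q : ℝ := Real.exp (-(κ * h / 2)) with hq
  set α₀ : ℝ := 1 + q with hα₀
  set β : ℝ → ℝ := fun v => α₀ / (1 + Real.exp (-(κ * (v - (xw - h / 2))))) with hβ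
  have hqpos : 0 < q := Real.exp_pos _
  have hα1 : 1 ≤ α₀ := by simp only [hα₀]; linarith
  have hα0 : 0 ≤ α₀ := by linarith
  have hβC : ContDiff ℝ 1 β := contDiff_logisticWeight κ (xw - h / 2) α₀
  have hβ0 : ∀ v, 0 ≤ β v := fun v => (logisticWeight_mem hα0 κ (xw - h / 2) v).1
  have hβ1 : ∀ v, β v ≤ α₀ := fun v => (logisticWeight_mem hα0 κ (xw - h / 2) v).2
  have hβ' : ∀ v, deriv β v ≤ κ * (α₀ - β v) := fun v =>
    deriv_logisticWeight_le hκ hα0 (xw - h / 2) v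
  have hβw : 1 ≤ β xw := by
    simp only [hβ, hα₀, hq]
    exact (logisticWeight_top κ xw h).ge
  have hβdata : ∀ x, x ≤ xw - h → β x ≤ q := fun x hx => by
    simp only [hβ, hα₀, hq]
    exact logisticWeight_le_of_le hκ hx
  -- forward estimate for `ψ`
  have hF := fun (t : ℝ) (ht : 0 ≤ t) =>
    wave1D_nearWindow_forward_ge hV hV0 hmono hα1 hβC hβ0 hβ1 hβ' hβw hψ hsol hfinIic ht
  -- the time-reversed solution
  obtain ⟨hψ', hsol', he'⟩ := wave1D_timeReversal hψ hsol
  have hdn : ∀ x, deriv (fun τ => (fun t x => ψ (-t) x) τ x) 0 = -deriv (fun τ => ψ τ x) 0 := by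
    intro x
    have := deriv_comp_neg (fun τ => ψ τ x) 0
    simpa using this
  have hfinIic' : ∫⁻ x in Iic xw, ENNReal.ofReal (deriv (fun τ => (fun t x => ψ (-t) x) τ x) 0 ^ 2
      + deriv ((fun t x => ψ (-t) x) 0) x ^ 2 + V x * (fun t x => ψ (-t) x) 0 x ^ 2) ≠ ⊤ := by
    simp only [he', neg_zero]
    exact hfinIic
  have hB := fun (t : ℝ) (ht : 0 ≤ t) =>
    wave1D_nearWindow_forward_ge hV hV0 hmono hα1 hβC hβ0 hβ1 hβ' hβw hψ' hsol' hfinIic' ht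
  -- the two deficits
  set A : ℝ := ∫ x in Iic xw, (e0 x - (1 / 2) * (β x * (deriv (fun τ => ψ τ x) 0 + deriv (ψ 0) x) ^ 2
    + α₀ * (deriv (fun τ => ψ τ x) 0 - deriv (ψ 0) x) ^ 2 + (α₀ + β x) * V x * ψ 0 x ^ 2)) with hA
  set B : ℝ := ∫ x in Iic xw, (e0 x - (1 / 2) * (β x * (-deriv (fun τ => ψ τ x) 0 + deriv (ψ 0) x) ^ 2
    + α₀ * (-deriv (fun τ => ψ τ x) 0 - deriv (ψ 0) x) ^ 2 + (α₀ + β x) * V x * ψ 0 x ^ 2)) with hB'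
  -- forward: `ofReal A ≤ liminf⁺`
  have hfwd : ENNReal.ofReal A ≤ liminf (fun t => ∫⁻ x in Iio (xw - t), ENNReal.ofReal
      (deriv (fun τ => ψ τ x) t ^ 2 + deriv (ψ t) x ^ 2 + V x * ψ t x ^ 2)) atTop := by
    refine le_liminf_of_le (h := ?_)
    filter_upwards [eventually_ge_atTop 0] with t ht
    exact hF t ht
  -- backward: `ofReal B ≤ liminf⁻`
  have hbwd : ENNReal.ofReal B ≤ liminf (fun t => ∫⁻ x in Iio (xw + t), ENNReal.ofReal
      (deriv (fun τ => ψ τ x) t ^ 2 + deriv (ψ t) x ^ 2 + V x * ψ t x ^ 2)) atBot := by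
    refine le_liminf_of_le (h := ?_)
    filter_upwards [eventually_le_atBot 0] with t ht
    have h := hB (-t) (by linarith)
    simp only [he', neg_neg, neg_zero, hdn] at h
    have hset : xw - -t = xw + t := by ring
    rw [hset] at h
    refine le_trans (le_of_eq ?_) (le_of_le_of_eq h rfl)
    congr 1
    rw [hB']
    congr 1
    funext x
    simp only [he0]
    ring
  -- the sum of the deficits
  have he0_int : IntegrableOn e0 (Iic xw) := by
    refine ⟨he0_cont.aestronglyMeasurable, ?_⟩
    rw [hasFiniteIntegral_iff_ofReal (ae_of_all _ fun x => he0_nn x)]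
    exact lt_top_iff_ne_top.2 hfinIic
  have hAB : (1 - 2 * q) * ∫ x in Iic xw, e0 x ≤ A + B := by
    have hβc : Continuous β := hβC.continuous
    -- integrands
    set fA : ℝ → ℝ := fun x => e0 x - (1 / 2) * (β x * (deriv (fun τ => ψ τ x) 0 + deriv (ψ 0) x) ^ 2
      + α₀ * (deriv (fun τ => ψ τ x) 0 - deriv (ψ 0) x) ^ 2 + (α₀ + β x) * V x * ψ 0 x ^ 2) with hfA
    set fB : ℝ → ℝ := fun x => e0 x - (1 / 2) * (β x * (-deriv (fun τ => ψ τ x) 0 + deriv (ψ 0) x) ^ 2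
      + α₀ * (-deriv (fun τ => ψ τ x) 0 - deriv (ψ 0) x) ^ 2 + (α₀ + β x) * V x * ψ 0 x ^ 2)
      with hfB
    have hsum : ∀ x, fA x + fB x = (2 - α₀ - β x) * e0 x := fun x => by
      simp only [hfA, hfB, he0]
      ring
    have hpt : ∀ x, (1 - 2 * q) * e0 x ≤ fA x + fB x := fun x => by
      rw [hsum x]
      rcases le_or_gt x (xw - h) with hx | hx
      · have hb := hβdata x hx
        have := he0_nn x
        simp only [hα₀]
        nlinarith
      · rw [he0_zero x hx]
        simp
    have hbound : ∀ x, |fA x| ≤ (1 + 2 * α₀) * e0 x ∧ |fB x| ≤ (1 + 2 * α₀) * e0 x := by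
      intro x
      have hb0 := hβ0 x; have hb1 := hβ1 x; have hv := hV0 x; have he := he0_nn x
      set p := deriv (fun τ => ψ τ x) 0
      set r := deriv (ψ 0) x
      have hψ2 := sq_nonneg (ψ 0 x)
      have hZA : 0 ≤ β x * (p + r) ^ 2 + α₀ * (p - r) ^ 2 + (α₀ + β x) * V x * ψ 0 x ^ 2 := by
        positivity
      have hZB : 0 ≤ β x * (-p + r) ^ 2 + α₀ * (-p - r) ^ 2 + (α₀ + β x) * V x * ψ 0 x ^ 2 := by
        positivity
      have hZA' : β x * (p + r) ^ 2 + α₀ * (p - r) ^ 2 + (α₀ + β x) * V x * ψ 0 x ^ 2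
          ≤ 2 * α₀ * e0 x := by
        simp only [he0]
        nlinarith [mul_le_mul_of_nonneg_right hb1 (sq_nonneg (p + r)),
          mul_le_mul_of_nonneg_right hb1 (mul_nonneg hv hψ2), sq_nonneg (p - r), sq_nonneg (p + r),
          mul_nonneg hα0 (sq_nonneg (p + r)), mul_nonneg hα0 (sq_nonneg (p - r))]
      have hZB' : β x * (-p + r) ^ 2 + α₀ * (-p - r) ^ 2 + (α₀ + β x) * V x * ψ 0 x ^ 2
          ≤ 2 * α₀ * e0 x := by
        simp only [he0]
        nlinarith [mul_le_mul_of_nonneg_right hb1 (sq_nonneg (-p + r)),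
          mul_le_mul_of_nonneg_right hb1 (mul_nonneg hv hψ2), sq_nonneg (-p - r), sq_nonneg (-p + r),
          mul_nonneg hα0 (sq_nonneg (-p + r)), mul_nonneg hα0 (sq_nonneg (-p - r))]
      simp only [hfA, hfB]
      constructor <;> rw [abs_le] <;> constructor <;> nlinarith
    have hfA_cont : Continuous fA := by
      simp only [hfA, he0, hd1, hd2]
      have ha : Continuous fun p : ℝ × ℝ => ψt p.1 p.2 := hct
      have hb' : Continuous fun p : ℝ × ℝ => ψx p.1 p.2 := hcx
      have hc : Continuous fun p : ℝ × ℝ => ψ p.1 p.2 := hψ.continuous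
      fun_prop
    have hfB_cont : Continuous fB := by
      simp only [hfB, he0, hd1, hd2]
      have ha : Continuous fun p : ℝ × ℝ => ψt p.1 p.2 := hct
      have hb' : Continuous fun p : ℝ × ℝ => ψx p.1 p.2 := hcx
      have hc : Continuous fun p : ℝ × ℝ => ψ p.1 p.2 := hψ.continuous
      fun_prop
    have hfA_int : IntegrableOn fA (Iic xw) :=
      Integrable.mono' (he0_int.const_mul (1 + 2 * α₀)) hfA_cont.aestronglyMeasurable
        (ae_of_all _ fun x => by rw [Real.norm_eq_abs]; exact (hbound x).1)
    have hfB_int : IntegrableOn fB (Iic xw) :=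
      Integrable.mono' (he0_int.const_mul (1 + 2 * α₀)) hfB_cont.aestronglyMeasurable
        (ae_of_all _ fun x => by rw [Real.norm_eq_abs]; exact (hbound x).2)
    have hAB' : A + B = ∫ x in Iic xw, (fA x + fB x) := by
      simp only [hA, hB', hfA, hfB]
      rw [← integral_add hfA_int hfB_int]
    rw [hAB', ← MeasureTheory.integral_const_mul]
    exact setIntegral_mono_on (he0_int.const_mul _) (hfA_int.add hfB_int) measurableSet_Iic
      fun x _ => hpt x
  -- the total energy is the energy below `xw`
  have htot : (∫⁻ x, ENNReal.ofReal (e0 x)) = ENNReal.ofReal (∫ x in Iic xw, e0 x) := by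
    have hsplit := lintegral_add_compl (μ := volume) (fun x => ENNReal.ofReal (e0 x))
      (measurableSet_Iic (a := xw))
    have hzero : (∫⁻ x in (Iic xw)ᶜ, ENNReal.ofReal (e0 x)) = 0 := by
      rw [compl_Iic]
      refine setLIntegral_eq_zero measurableSet_Ioi ?_
      intro x hx
      have hx' : xw - h < x := by linarith [mem_Ioi.1 hx]
      simp [he0_zero x hx']
    rw [← hsplit, hzero, add_zero,
      ofReal_integral_eq_lintegral_ofReal he0_int (ae_of_all _ fun x => he0_nn x)]
  -- conclusion
  rcases le_or_gt (1 - 2 * q) 0 with hc | hc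
  · rw [ENNReal.ofReal_of_nonpos hc, zero_mul]
    exact bot_le
  have hE0 : 0 ≤ ∫ x in Iic xw, e0 x := setIntegral_nonneg measurableSet_Iic fun x _ => he0_nn x
  calc ENNReal.ofReal (1 - 2 * q) * ∫⁻ x, ENNReal.ofReal (e0 x)
      = ENNReal.ofReal ((1 - 2 * q) * ∫ x in Iic xw, e0 x) := by
        rw [htot, ← ENNReal.ofReal_mul hc.le]
    _ ≤ ENNReal.ofReal (A + B) := ENNReal.ofReal_le_ofReal hAB
    _ ≤ ENNReal.ofReal A + ENNReal.ofReal B := ENNReal.ofReal_add_le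
    _ ≤ _ := add_le_add hfwd hbwd

end TwoSided

end Literature.Analysis.PDE
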